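import Mathlib
import Summits.Ventures.PercRepro2.ExplorationTreeCov
import Summits.Ventures.PercRepro2.ObsIndependence

/-!
# The unexplored part is fresh at the leaf: the strong Markov property of the exploration process
(blind cell PercRepro2, typer-1 g20; a language line)

`ExplorationTreeCondExp.lean` identified the conditional expectation given a stopping exploration
with the pinned expectation at its leaf, `μ_p[f | leafSigma t] =ᵐ leafMean p t f`.  This file adds
the classical reading of that identity — *what is not yet explored is an independent copy of the
original product measure*:

* **`expect_pin_eq_of_dependsOn_compl`**: an observable determined by the UNEXPLORED edges of `P`
  has the same mean under the pinned weights as under the original ones,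
  `E_{pin p P} f = E_p f` (any commutative ring, no `IsProbVec`);
* **`expect_pin_eq_of_dependsOn`**: an observable determined by the EXPLORED edges is the constant
  `f P.σ` under the pinned weights;
* **`expect_pin_mul_of_dependsOn`**: the two together, `E_{pin p P}(f · g) = f P.σ · E_p g`;
* **`leafMean_eq_expect_of_dependsOn`** / **`condExp_leafSigma_of_dependsOn`** (the strong Markov
  property): if the observable attached to each leaf `ℓ` depends only on the edges not explored at
  `ℓ`, then `μ_p[ω ↦ f (leafOf ω) ω | leafSigma t] =ᵐ ω ↦ E_p (f (leafOf ω))` — conditionally on the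
  exploration, the unexplored edges are fresh;
* **`Partial.freeze`** (the explored edges frozen at their record) and
  **`expect_pin_eq_expect_freeze`**: the pinned mean of ANY observable is an unconditional mean,
  `E_{pin p P} g = E_p (g ∘ P.freeze)`; the exploration formulas
  **`expect_eq_sum_leaves_freeze`** / **`prob_eq_sum_leaves_freeze`**,
  `P_p(B) = Σ_ℓ P_p(ℓ) · P_p(ℓ.freeze⁻¹ B)` for every event and every valid tree, and the strong
  Markov property for every observable, **`condExp_leafSigma_freeze`**:
  `μ_p[g | leafSigma t] =ᵐ ω ↦ E_p (g ∘ (leafOf ω).freeze)`; the within-leaf covariances are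
  unconditional covariances of the frozen observables (`covariance_pin_eq_covariance_freeze`), so
  the law of total covariance of `ExplorationTreeCov.lean` reads
  `cov[f, g] = Σ_ℓ P_p(ℓ) · cov[f ∘ ℓ.freeze, g ∘ ℓ.freeze] + cov[leafMean f, leafMean g]`
  (**`covariance_eq_sum_leaves_freeze_add_covariance_leafMean`**);
* **`expect_eq_sum_leaves_of_dependsOn`** / **`prob_eq_sum_leaves_of_dependsOn`** (events built
  from explorations): if on every leaf `ℓ` the event `B` coincides with an event `A ℓ` of the
  unexplored edges, then `P_p(B) = Σ_ℓ P_p(ℓ) · P_p(A ℓ)`; **`prob_eq_sum_leaves_of_determined`**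
  for an event decided by the leaf, `P_p(B) = Σ_{ℓ : d ℓ} P_p(ℓ)`.

Identities only; no sign is claimed; the crux and the residual are as they are.
-/

namespace Summit.Ventures.PercRepro2

open MeasureTheory ProbabilityTheory MeasureBridge

namespace ExplorationTree

/-! ## Explored and unexplored observables under the pinned weights -/

section Fresh

variable {E : Type*} [Fintype E] [DecidableEq E] {R : Type*} [CommRing R]

/-- **Weights on `F` do not matter for observables of `Fᶜ`**: two weight vectors that agree off
`F` give the same mean to every observable determined by the edges outside `F` (any commutative
ring). -/
theorem expect_eq_of_eqOn_compl (p q : E → R) (F : Set E) [DecidablePred (· ∈ F)]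
    (hq : ∀ e ∉ F, q e = p e) {f : Config E → R} (hf : DependsOn f Fᶜ) :
    expect q f = expect p f := by
  let b : ({e // e ∉ F} → Bool) → R := fun σ₂ => f (glue F (fun _ => false) σ₂)
  have hb : ∀ σ₁ σ₂, f (glue F σ₁ σ₂) = b σ₂ := fun σ₁ σ₂ =>
    hf fun i hi => by rw [glue_apply_of_notMem F _ _ hi, glue_apply_of_notMem F _ _ hi]
  have key : ∀ r : E → R, (∀ e ∉ F, r e = p e) →
      expect r f = ∑ σ₂ : {e // e ∉ F} → Bool, weight (fun i : {e // e ∉ F} => p i) σ₂ * b σ₂ := by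
    intro r hr
    rw [expect_eq_sum_glue r f F, Finset.sum_comm]
    refine Finset.sum_congr rfl fun σ₂ _ => ?_
    have hw : weight (fun i : {e // e ∉ F} => r i) σ₂ = weight (fun i : {e // e ∉ F} => p i) σ₂ := by
      unfold weight
      exact Finset.prod_congr rfl fun i _ => by simp only [hr i i.2]
    calc ∑ σ₁ : {e // e ∈ F} → Bool, weight (fun i : {e // e ∈ F} => r i) σ₁ *
            weight (fun i : {e // e ∉ F} => r i) σ₂ * f (glue F σ₁ σ₂)
        = ∑ σ₁ : {e // e ∈ F} → Bool, (weight (fun i : {e // e ∉ F} => p i) σ₂ * b σ₂) *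
            weight (fun i : {e // e ∈ F} => r i) σ₁ :=
          Finset.sum_congr rfl fun σ₁ _ => by rw [hb, hw]; ring
      _ = weight (fun i : {e // e ∉ F} => p i) σ₂ * b σ₂ := by
          rw [← Finset.mul_sum, sum_weight, mul_one]
  rw [key q hq, key p (fun _ _ => rfl)]

/-- **The unexplored part is fresh**: an observable determined by the edges NOT explored at `P` has
the same mean under the pinned weights `pin p P` as under `p` (any commutative ring). -/
theorem expect_pin_eq_of_dependsOn_compl (p : E → R) (P : Partial E) {f : Config E → R}
    (hf : DependsOn f ((↑P.F : Set E)ᶜ)) : expect (pin p P) f = expect p f :=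
  expect_eq_of_eqOn_compl p (pin p P) (↑P.F : Set E)
    (fun _ he => pin_of_notMem p P (fun h => he (Finset.mem_coe.2 h))) hf

/-- **The explored part is deterministic**: an observable determined by the explored edges of `P`
is the constant `f P.σ` under the pinned weights. -/
theorem expect_pin_eq_of_dependsOn (p : E → R) (P : Partial E) {f : Config E → R}
    (hf : DependsOn f (↑P.F : Set E)) : expect (pin p P) f = f P.σ := by
  rw [expect_pin_congr p P (g := fun _ => f P.σ) (fun ω hω => hf fun e he => hω e he),
    expect_const]

/-- **Explored × unexplored under the pinned weights**: `E_{pin p P}(f · g) = f P.σ · E_p g` for `f`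
determined by the explored edges and `g` by the unexplored ones. -/
theorem expect_pin_mul_of_dependsOn (p : E → R) (P : Partial E) {f g : Config E → R}
    (hf : DependsOn f (↑P.F : Set E)) (hg : DependsOn g ((↑P.F : Set E)ᶜ)) :
    expect (pin p P) (f * g) = f P.σ * expect p g := by
  have h1 : expect (pin p P) (f * g) = expect (pin p P) (fun ω => f P.σ * g ω) :=
    expect_pin_congr p P fun ω hω => by
      simp only [Pi.mul_apply]
      rw [hf fun e he => hω e he]
  rw [h1, expect_const_mul, expect_pin_eq_of_dependsOn_compl p P hg]

/-- The same, as a product of pinned means: explored and unexplored observables are independent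
under the pinned weights. -/
theorem expect_pin_mul_eq_mul_of_dependsOn (p : E → R) (P : Partial E) {f g : Config E → R}
    (hf : DependsOn f (↑P.F : Set E)) (hg : DependsOn g ((↑P.F : Set E)ᶜ)) :
    expect (pin p P) (f * g) = expect (pin p P) f * expect (pin p P) g := by
  rw [expect_pin_mul_of_dependsOn p P hf hg, expect_pin_eq_of_dependsOn p P hf,
    expect_pin_eq_of_dependsOn_compl p P hg]

/-- The pinned probability of an event of the unexplored edges is its unconditional probability. -/
theorem prob_pin_eq_of_dependsOn_compl (p : E → R) (P : Partial E) {A : Set (Config E)}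
    (hA : DependsOn (· ∈ A) ((↑P.F : Set E)ᶜ)) : prob (pin p P) A = prob p A := by
  rw [prob_eq_expect_indicator, prob_eq_expect_indicator]
  exact expect_pin_eq_of_dependsOn_compl p P (dependsOn_indicator hA)

end Fresh

/-! ## Freezing the record: the pinned mean of ANY observable is an unconditional mean -/

section Freeze

variable {E : Type*} [DecidableEq E]

/-- The configuration `ω` with the explored edges frozen at their record: `P.σ` on `P.F`, `ω`
elsewhere. -/
def Partial.freeze (P : Partial E) (ω : Config E) : Config E :=
  fun e => if e ∈ P.F then P.σ e else ω e

/-- `freeze` on an explored edge. -/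
lemma Partial.freeze_apply_of_mem (P : Partial E) (ω : Config E) {e : E} (he : e ∈ P.F) :
    P.freeze ω e = P.σ e := by
  simp [Partial.freeze, he]

/-- `freeze` on an unexplored edge. -/
lemma Partial.freeze_apply_of_notMem (P : Partial E) (ω : Config E) {e : E} (he : e ∉ P.F) :
    P.freeze ω e = ω e := by
  simp [Partial.freeze, he]

/-- The frozen configuration lies in the event of `P`. -/
lemma Partial.freeze_mem_event (P : Partial E) (ω : Config E) : P.freeze ω ∈ P.event :=
  fun _ he => P.freeze_apply_of_mem ω he

/-- On the event of `P`, freezing does nothing. -/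
lemma Partial.freeze_eq_of_mem_event (P : Partial E) {ω : Config E} (hω : ω ∈ P.event) :
    P.freeze ω = ω := by
  funext e
  by_cases he : e ∈ P.F
  · rw [P.freeze_apply_of_mem ω he, hω e he]
  · exact P.freeze_apply_of_notMem ω he

/-- An observable composed with `freeze` is determined by the unexplored edges. -/
lemma dependsOn_comp_freeze {α : Type*} (P : Partial E) (g : Config E → α) :
    DependsOn (g ∘ P.freeze) ((↑P.F : Set E)ᶜ) := by
  intro ω ω' h
  simp only [Function.comp_apply]
  congr 1
  funext e
  by_cases he : e ∈ P.F
  · rw [P.freeze_apply_of_mem ω he, P.freeze_apply_of_mem ω' he]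
  · rw [P.freeze_apply_of_notMem ω he, P.freeze_apply_of_notMem ω' he]
    exact h e he

variable [Fintype E] {R : Type*} [CommRing R]

/-- **The strong Markov property, finite-sum form**: the pinned mean of ANY observable `g` is the
unconditional mean of `g` with the explored edges frozen at their record,
`E_{pin p P} g = E_p (g ∘ P.freeze)` (any commutative ring). -/
theorem expect_pin_eq_expect_freeze (p : E → R) (P : Partial E) (g : Config E → R) :
    expect (pin p P) g = expect p (g ∘ P.freeze) := by
  rw [expect_pin_congr p P (g := g ∘ P.freeze) fun ω hω => by
    simp only [Function.comp_apply, P.freeze_eq_of_mem_event hω]]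
  exact expect_pin_eq_of_dependsOn_compl p P (dependsOn_comp_freeze P g)

/-- The pinned probability of ANY event `B` is the unconditional probability of `B` with the
explored edges frozen: `P_{pin p P}(B) = P_p(freeze⁻¹ B)`. -/
theorem prob_pin_eq_prob_preimage_freeze (p : E → R) (P : Partial E) (B : Set (Config E)) :
    prob (pin p P) B = prob p (P.freeze ⁻¹' B) := by
  rw [prob_eq_expect_indicator, prob_eq_expect_indicator, expect_pin_eq_expect_freeze]
  rfl

/-- **The exploration formula for expectations**: for every observable `g` and every valid tree,
`E_p g = Σ_{ℓ ∈ leaves t root} P_p(ℓ) · E_p (g ∘ ℓ.freeze)` (any commutative ring). -/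
theorem expect_eq_sum_leaves_freeze (p : E → R) (t : ETree E) (hv : Valid t ∅)
    (g : Config E → R) :
    expect p g = ((leaves t root).map fun ℓ => prob p ℓ.event * expect p (g ∘ ℓ.freeze)).sum := by
  rw [expect_eq_sum_leaves_pin p t hv g]
  congr 1
  refine List.map_congr_left fun ℓ _ => ?_
  rw [expect_pin_eq_expect_freeze]

/-- **The exploration formula for events**: for every event `B` and every valid tree,
`P_p(B) = Σ_{ℓ ∈ leaves t root} P_p(ℓ) · P_p(ℓ.freeze⁻¹ B)`. -/
theorem prob_eq_sum_leaves_freeze (p : E → R) (t : ETree E) (hv : Valid t ∅)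
    (B : Set (Config E)) :
    prob p B = ((leaves t root).map fun ℓ => prob p ℓ.event * prob p (ℓ.freeze ⁻¹' B)).sum := by
  rw [prob_eq_expect_indicator, expect_eq_sum_leaves_freeze p t hv]
  congr 1
  refine List.map_congr_left fun ℓ _ => ?_
  rw [← expect_pin_eq_expect_freeze, ← prob_eq_expect_indicator, prob_pin_eq_prob_preimage_freeze]

end Freeze

/-! ## Events and observables built from an exploration -/

section Leaves

variable {E : Type*} [Fintype E] [DecidableEq E] {R : Type*} [CommRing R]

/-- **Observables built from an exploration**: if on every leaf `ℓ` the observable `g` coincides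
with an observable `f ℓ` of the edges not explored at `ℓ`, then
`E_p g = Σ_{ℓ ∈ leaves t root} P_p(ℓ) · E_p (f ℓ)` (any commutative ring). -/
theorem expect_eq_sum_leaves_of_dependsOn (p : E → R) (t : ETree E) (hv : Valid t ∅)
    (g : Config E → R) (f : Partial E → Config E → R)
    (hf : ∀ ℓ ∈ leaves t root, DependsOn (f ℓ) ((↑ℓ.F : Set E)ᶜ))
    (hg : ∀ ℓ ∈ leaves t root, ∀ ω ∈ ℓ.event, g ω = f ℓ ω) :
    expect p g = ((leaves t root).map fun ℓ => prob p ℓ.event * expect p (f ℓ)).sum := by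
  rw [expect_eq_sum_leaves_pin p t hv g]
  congr 1
  refine List.map_congr_left fun ℓ hℓ => ?_
  rw [expect_pin_congr p ℓ (hg ℓ hℓ), expect_pin_eq_of_dependsOn_compl p ℓ (hf ℓ hℓ)]

/-- **Events built from an exploration**: if on every leaf `ℓ` the event `B` coincides with an
event `A ℓ` of the edges not explored at `ℓ`, then `P_p(B) = Σ_ℓ P_p(ℓ) · P_p(A ℓ)`. -/
theorem prob_eq_sum_leaves_of_dependsOn (p : E → R) (t : ETree E) (hv : Valid t ∅)
    (B : Set (Config E)) (A : Partial E → Set (Config E))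
    (hA : ∀ ℓ ∈ leaves t root, DependsOn (· ∈ A ℓ) ((↑ℓ.F : Set E)ᶜ))
    (hB : ∀ ℓ ∈ leaves t root, ∀ ω ∈ ℓ.event, (ω ∈ B ↔ ω ∈ A ℓ)) :
    prob p B = ((leaves t root).map fun ℓ => prob p ℓ.event * prob p (A ℓ)).sum := by
  rw [prob_eq_expect_indicator]
  rw [expect_eq_sum_leaves_of_dependsOn p t hv (B.indicator 1) (fun ℓ => (A ℓ).indicator 1)
    (fun ℓ hℓ => dependsOn_indicator (hA ℓ hℓ)) (fun ℓ hℓ ω hω => ?_)]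
  · congr 1
    refine List.map_congr_left fun ℓ _ => ?_
    rw [prob_eq_expect_indicator p (A ℓ)]
  · by_cases h : ω ∈ B
    · rw [Set.indicator_of_mem h, Set.indicator_of_mem ((hB ℓ hℓ ω hω).1 h)]
    · rw [Set.indicator_of_notMem h, Set.indicator_of_notMem (fun h' => h ((hB ℓ hℓ ω hω).2 h'))]

/-- A list identity: summing `w` where `d` holds is summing `w` over the filtered list. -/
lemma sum_map_ite {ι : Type*} (l : List ι) (w : ι → R) (d : ι → Prop) [DecidablePred d] :
    (l.map fun i => if d i then w i else 0).sum = ((l.filter fun i => d i).map w).sum := by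
  induction l with
  | nil => simp
  | cons a l ih =>
    by_cases h : d a
    · simp [h, ih]
    · simp [h, ih]

/-- **Events decided by the leaf**: if on every leaf `ℓ` the event `B` is decided (`d ℓ`), then
`P_p(B) = Σ_{ℓ ∈ leaves t root, d ℓ} P_p(ℓ)`. -/
theorem prob_eq_sum_leaves_of_determined (p : E → R) (t : ETree E) (hv : Valid t ∅)
    (B : Set (Config E)) (d : Partial E → Prop) [DecidablePred d]
    (hB : ∀ ℓ ∈ leaves t root, ∀ ω ∈ ℓ.event, (ω ∈ B ↔ d ℓ)) :
    prob p B = (((leaves t root).filter fun ℓ => d ℓ).map fun ℓ => prob p ℓ.event).sum := by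
  rw [prob_eq_sum_leaves_of_dependsOn p t hv B (fun ℓ => if d ℓ then Set.univ else ∅)
    (fun ℓ _ => ?_) (fun ℓ hℓ ω hω => ?_)]
  · have h1 : ∀ ℓ, prob p ℓ.event * prob p (if d ℓ then (Set.univ : Set (Config E)) else ∅) =
        if d ℓ then prob p ℓ.event else 0 := by
      intro ℓ
      split_ifs <;> simp
    simp_rw [h1]
    exact sum_map_ite _ _ _
  · by_cases h : d ℓ
    · rw [if_pos h]; exact fun _ _ _ => rfl
    · rw [if_neg h]; exact fun _ _ _ => rfl
  · by_cases h : d ℓ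
    · simp only [if_pos h, Set.mem_univ, iff_true]; exact (hB ℓ hℓ ω hω).2 h
    · simp only [if_neg h, Set.mem_empty_iff_false, iff_false]
      exact fun h' => h ((hB ℓ hℓ ω hω).1 h')

end Leaves

/-! ## The strong Markov property of the exploration process -/

section StrongMarkov

variable {E : Type*} [Fintype E] [DecidableEq E]

/-- **The pinned mean of a leaf-indexed observable of the unexplored edges is the unconditional
mean**: if `f ℓ` depends only on the edges not explored at `ℓ`, then
`leafMean p t (ω ↦ f (leafOf ω) ω) = ω ↦ E_p (f (leafOf ω))`. -/
theorem leafMean_eq_expect_of_dependsOn (p : E → ℝ) (t : ETree E) (hv : Valid t ∅)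
    (f : Partial E → Config E → ℝ)
    (hf : ∀ ℓ ∈ leaves t root, DependsOn (f ℓ) ((↑ℓ.F : Set E)ᶜ)) :
    leafMean p t (fun ω => f (leafOf t root ω) ω) = fun ω => expect p (f (leafOf t root ω)) := by
  funext ω
  simp only [leafMean]
  have hℓ : leafOf t root ω ∈ leaves t root := leafOf_mem_leaves t root ω
  rw [expect_pin_congr p (leafOf t root ω) (g := f (leafOf t root ω)) fun ω' hω' => by
    rw [leafOf_eq_of_mem_event t root hv _ hℓ ω' hω']]
  exact expect_pin_eq_of_dependsOn_compl p _ (hf _ hℓ)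

/-- **The strong Markov property of the exploration process**: conditionally on a stopping
exploration, an observable of the edges not yet explored at the leaf has its unconditional mean —
`μ_p[ω ↦ f (leafOf ω) ω | leafSigma t] =ᵐ ω ↦ E_p (f (leafOf ω))` for every weight vector and
every valid tree. -/
theorem condExp_leafSigma_of_dependsOn (p : E → ℝ) (hp : IsProbVec p) (t : ETree E)
    (hv : Valid t ∅) (f : Partial E → Config E → ℝ)
    (hf : ∀ ℓ ∈ leaves t root, DependsOn (f ℓ) ((↑ℓ.F : Set E)ᶜ)) :
    (percMeasureOf p hp)[fun ω => f (leafOf t root ω) ω | leafSigma t] =ᵐ[percMeasureOf p hp]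
      fun ω => expect p (f (leafOf t root ω)) := by
  have h := condExp_leafSigma p hp t hv (fun ω => f (leafOf t root ω) ω)
  rwa [leafMean_eq_expect_of_dependsOn p t hv f hf] at h

/-- The special case of ONE observable of the edges not explored at any leaf: it is independent of
the exploration, `μ_p[f | leafSigma t] =ᵐ E_p f`. -/
theorem condExp_leafSigma_eq_const_of_dependsOn (p : E → ℝ) (hp : IsProbVec p) (t : ETree E)
    (hv : Valid t ∅) (f : Config E → ℝ)
    (hf : ∀ ℓ ∈ leaves t root, DependsOn f ((↑ℓ.F : Set E)ᶜ)) :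
    (percMeasureOf p hp)[f | leafSigma t] =ᵐ[percMeasureOf p hp] fun _ => expect p f :=
  condExp_leafSigma_of_dependsOn p hp t hv (fun _ => f) hf

/-- **The pinned mean at the leaf is an unconditional mean**: `leafMean p t g` at `ω` is the mean
of `g` with the edges explored at the leaf of `ω` frozen at their record. -/
theorem leafMean_eq_expect_freeze (p : E → ℝ) (t : ETree E) (g : Config E → ℝ) :
    leafMean p t g = fun ω => expect p (g ∘ (leafOf t root ω).freeze) := by
  funext ω
  simp only [leafMean]
  exact expect_pin_eq_expect_freeze p _ g

/-- **The strong Markov property of the exploration process, for every observable**: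
`μ_p[g | leafSigma t] =ᵐ ω ↦ E_p (g ∘ (leafOf ω).freeze)` — conditionally on a stopping
exploration, the observable is averaged over fresh unexplored edges with the explored ones frozen at
their record. -/
theorem condExp_leafSigma_freeze (p : E → ℝ) (hp : IsProbVec p) (t : ETree E) (hv : Valid t ∅)
    (g : Config E → ℝ) :
    (percMeasureOf p hp)[g | leafSigma t] =ᵐ[percMeasureOf p hp]
      fun ω => expect p (g ∘ (leafOf t root ω).freeze) := by
  have h := condExp_leafSigma p hp t hv g
  rwa [leafMean_eq_expect_freeze p t g] at h

/-- **Within-leaf covariances are unconditional covariances of the frozen observables**: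
`cov[f, g; μ_{pin p P}] = cov[f ∘ P.freeze, g ∘ P.freeze; μ_p]`. -/
theorem covariance_pin_eq_covariance_freeze (p : E → ℝ) (hp : IsProbVec p) (P : Partial E)
    (f g : Config E → ℝ) :
    cov[f, g; percMeasureOf (pin p P) (isProbVec_pin hp P)] =
      cov[f ∘ P.freeze, g ∘ P.freeze; percMeasureOf p hp] := by
  rw [EdgeSplit.covariance_percMeasureOf, EdgeSplit.covariance_percMeasureOf,
    expect_pin_eq_expect_freeze, expect_pin_eq_expect_freeze, expect_pin_eq_expect_freeze]
  rfl

/-- **The law of total covariance over a stopping exploration, frozen form**: WITHIN = the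
unconditional covariances of the observables with the leaf's record frozen, BETWEEN = the
covariance of the pinned means —
`cov[f, g] = Σ_ℓ P_p(ℓ) · cov[f ∘ ℓ.freeze, g ∘ ℓ.freeze] + cov[leafMean p t f, leafMean p t g]`. -/
theorem covariance_eq_sum_leaves_freeze_add_covariance_leafMean (p : E → ℝ) (hp : IsProbVec p)
    (t : ETree E) (hv : Valid t ∅) (f g : Config E → ℝ) :
    cov[f, g; percMeasureOf p hp] =
      ((leaves t root).map fun ℓ =>
        prob p ℓ.event * cov[f ∘ ℓ.freeze, g ∘ ℓ.freeze; percMeasureOf p hp]).sum +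
      cov[leafMean p t f, leafMean p t g; percMeasureOf p hp] := by
  rw [covariance_eq_sum_leaves_pin_add_covariance_leafMean p hp t hv f g]
  congr 2
  refine List.map_congr_left fun ℓ _ => ?_
  rw [covariance_pin_eq_covariance_freeze]

end StrongMarkov

end ExplorationTree

end Summit.Ventures.PercRepro2
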